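import Literature.NumberTheory.EllipticCurves.Castella2024.MultiplicativePConverse
import Literature.NumberTheory.EllipticCurves.Castella2024.LambdaAdicHeegnerClass
import HarnessLib

/-!
# Castella 2024 (arXiv:2409.01360v1, UNREFEREED), Theorem 1.3: the Heegner point main conjecture at a
# prime `p > 3` of MULTIPLICATIVE reduction with `E[p]` IRREDUCIBLE, with the class `𝐳_∞^*` (the
# `Λ`-adic Heegner class `𝐳_∞` at non-split `p`; its derivative `𝐳_∞'`, `𝐳_∞ = (γ-1)𝐳_∞'`, at split
# `p`) — as an explicitly labelled OPEN hypothesis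

HONEST FRAMING (cross-ladder LITERATURE-TYPING layer D-0088(4), cell `bsd-littype`; typed by seat
`bsd-littype-05` (re-seat g2) for seat `bsd-littype-11`'s paper, closing the GAP row recorded in
`Castella2024/MultiplicativePConverse.lean` (module docstring: "Theorems 1.3 / 2.1 / 2.2 are NOT
transcribed here: their objects (the regularized Heegner classes `z_m` of `p`-power conductor at a
prime `p ∣ N`, eq. (2.2); the derived class `κ_∞'`; …) have no tree vocabulary today") now that the
vocabulary exists (`Castella2024.IsLambdaAdicHeegnerClass`, file `LambdaAdicHeegnerClass.lean`).
F. Castella, *Exceptional zeros for Heegner points and `p`-converse to the theorem of Gross–Zagier and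
Kolyvagin*, arXiv:2409.01360v1 (2 Sep 2024) is an UNREFEREED PREPRINT; the one `def … : Prop` below
TRANSCRIBES its Theorem 1.3 with the suffix `_OPEN` and the tag `[claim: Castella2024, status:
under-review]` (D-0012), NEVER as a theorem; everything else is PROVED bookkeeping. Typed ≠ proved ≠
endorsed. The layout is the one of the Eisenstein sibling (Keller–Yin Thm. 5.2.1,
`KellerYin2024/MultiplicativeHeegnerPointMainConjecture.lean`: `E[p]` REDUCIBLE) and of the good-
reduction main conjectures (`CastellaGrossiSkinner2025.thmC_…`, `KellerYin2024.thmB_…_OPEN`):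
`LambdaAdicSelmerData` (`𝔖_p`), `HeegnerFamily`, `SelmerDualData` (`X`), hypothesis bundle as a
`structure … : Prop`. Theorem 2.2 (explicit reciprocity law, big logarithm at `p ∥ N`) and Conj. 3.3
(the Greenberg-Selmer "primitive" form) remain untyped (no tree object for `𝓛̃_𝔭`; conjectures are
not Literature).

## The source, verbatim (TeX e-print of record `run/shared/lean/pub/bsd-eis/lit/src/cas24-src/
## multiplicative-conv.tex`, line locators `l.NNN`; store text `[corpus: paper:arxiv-2409.01360]`)

* §1.1, l.258–261: "let `K` be an imaginary quadratic field of odd discriminant `-D_K < -4` and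
  satisfying the classical *Heegner hypothesis* relative to `N`: **(Heeg)** there exists an ideal
  `𝔑 ⊂ 𝒪_K` with `𝒪_K/𝔑 ≃ ℤ/Nℤ."** l.264–293: `𝔖_p := lim←_L lim←_r Sel_{p^r}(E/L)` (`L ⊂ K_∞`
  finite; corestriction, multiplication by `p`), the `Λ`-adic class `𝐳_∞ ∈ 𝔖_p` from the Heegner
  points `y_{p^m}` ([BD96, §2]), "a 'derived' Heegner class `𝐳_∞' ∈ 𝔖_p` defined by the relation
  `𝐳_∞ = (γ-1)𝐳_∞'`", `X = Hom_cts(Sel_{p^∞}(E/K_∞), ℚ_p/ℤ_p)`, and "`𝐳_∞^* ∈ 𝔖_p` stand[s] for the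
  `Λ`-adic Heegner class `𝐳_∞` or its derivative `𝐳_∞'` according to whether `E` has nonsplit or
  split multiplicative reduction at `p`, respectively."
* **Theorem 1.3** (label `thm:HPMC`, l.305–325; `[corpus: … p0003:L85–L101]`): "Let `E/ℚ` be an
  elliptic curve with multiplicative reduction at the prime `p > 3`, and let `K` be an imaginary
  quadratic field of odd discriminant `-D_K < -4` satisfying hypothesis (Heeg) relative to the
  conductor `N` of `E`. Assume that: (i) `E[p]` is irreducible as a `G_ℚ`-module, (ii) If `2` is
  nonsplit in `K`, then `2 ∥ N`, (iii) `E` has nonsplit multiplicative reduction at each prime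
  `q ∥ N` which is nonsplit in `K`, and that there is at least one such prime `q` at which `E[p]` is
  ramified, (iv) `E(ℚ_p)[p] = 0`. Then `X` and `𝔖_p` both have `Λ`-rank one with
  `char_Λ(X_tors) = char_Λ(𝔖_p/Λ𝐳_∞^*)²`, where the subscript `tors` denotes the maximal
  `Λ`-torsion submodule." Remark (l.327–330): "an extension of the Heegner point main conjecture in
  [PR-HP, Conj. B] to the multiplicative case, in a 'primitive' form reflected in the appearance of
  the derivative class `𝐳_∞'`".
* §2.1, l.359–370: "Throughout we assume that `p > 3` … In particular, the prime `p` splits in `K`,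
  say `p = 𝔭𝔭̄` … Fix once and for all an ideal `𝔑` as in (Heeg) with `𝔭 ∣ 𝔑`." §2.2, l.380: "`α`
  … `= 1` or `-1` according to whether `E` has split or nonsplit multiplicative reduction at `p`";
  eq. (2.2)–(2.3) (the objects of `LambdaAdicHeegnerClass.lean`): "When `E(K)[p] = 0` (so the
  `Λ`-module `𝔖_p` is torsion-free), `𝐳_∞'` is uniquely determined by (2.3)."
* Printed proof (l.836–841): "It follows from Theorem 1.10 in [CV-dur] and the definition of `𝐳_∞'`
  that the `Λ`-adic Heegner class `𝐳_∞^*` is non-torsion …, and by the same argument as in [BCK, Cor.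
  4.5], this yields `loc_𝔭(𝔖_p) ≠ 0`. In view of Proposition 3.2, the result now follows from Theorem
  3.1" — Thm. 3.1 = the author's erratum to Camb. J. Math. 2018 Thm. 1.1 (tree
  `Castella2018.erratumThm11_…_OPEN`, resting on Fouquet–Wan arXiv:2107.13726); Prop. 3.2 =
  equivalence (i) ⟺ (ii) from the explicit reciprocity law Thm. 2.2 / Cor. 2.3 ("as in [BCK, Thm.
  5.1] … extracted from the arguments in [cas-BF, Appendix A]"): PRE ∘ PRE.

## Transcription (tree vocabulary only; nothing re-declared)

* `Thm13Hypotheses N W K p κ γ` (for a globally minimal `W`, as `Castella2024.Hypotheses` of Thm.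
  1.1 — `Δ_min` is read off the model): `E` elliptic of conductor `N`; "`p > 3`" — `5 ≤ p`;
  multiplicative at `p` — `HasMultiplicativeReductionAtPrime`; `K` imaginary quadratic, "odd
  discriminant `-D_K < -4`" — `Odd (discr K) ∧ discr K < -4`; (Heeg) VERBATIM in the ideal form —
  `∃ 𝔑 : Ideal (𝓞 K), Nonempty (𝓞 K ⧸ 𝔑 ≃+* ZMod N)` (it allows ramified primes `q ∥ N`; the tree's
  `SatisfiesHeegnerHypothesis` = "all primes dividing `N` split" is the stricter special case,
  `Quadratic.exists_ideal_quotient_ringEquiv_zmod_of_ncard_eq_two`); "`p` splits in `K`" (§2.1,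
  printed as standing; it does NOT follow from (Heeg) when `p ∣ D_K`, so it is kept as a field —
  flag `C13-spl`); (i) `HasIrreducibleModPGaloisRep`; (ii) LITERALLY "`2` nonsplit ⟹ `2 ∥ N`"
  (`(primesOver 2).ncard ≠ 2 → 2 ∣ N ∧ ¬ 4 ∣ N`; flag `C13-two`: with (Heeg) and `D_K` odd a
  nonsplit `2` is inert and cannot divide `N`, so (ii) then amounts to "`2` splits in `K`" — typed as
  printed, not as re-derived); (iii) "nonsplit in `K`" = not split (`ncard ≠ 2`, inert or ramified),
  "`q ∥ N`" = `q ∣ N ∧ ¬ q² ∣ N`, "nonsplit multiplicative" = `Mult ∧ ¬ SplitMult`, "`E[p]` ramified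
  at `q`" (a multiplicative `q ≠ p`) = `¬ p ∣ ord_q(Δ_min)` — the reading of
  `Castella2024.Hypotheses` (ii) and of `Castella2018.erratum_thmAprime_…` (Tate parametrisation);
  (iv) as `Castella2024.Hypotheses` (iii); `κ` anticyclotomic, `γ` a topological generator; AND the
  EXTRA `p ∤ h_K` of the tree's Heegner-family vocabulary (flag `C13-hK`, as `KYB-hK`/`KY521-hK`).
* `𝔖_p` = `D.S`, `X` = `X.X` (classical Selmer limits — exactly Castella's objects, no dictionary
  flag needed here), `𝐳_∞^*` through `IsLambdaAdicHeegnerClass D F α z` with `α = a_p`: non-split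
  (`α = -1`) `𝐳_∞^* = z`; split (`α = 1`) `∃ z', z = T • z' ∧ …` (EXISTENTIAL — Castella's `𝐳_∞'` is
  a specific class, unique when `𝔖_p` is torsion-free, e.g. when `E(K)[p] = 0`, §2.2; flag
  `C13-deriv`, WEAKER-or-equal); `∀ z` with the defining property (at most one,
  `IsLambdaAdicHeegnerClass.unique`; existence = BD96 Prop. 2.7, not asserted) — WEAKER-or-equal.

## Flags (nothing hidden): `C13-hK` (EXTRA, scope WEAKER) · `C13-spl` (standing "p splits" kept as a
## field) · `C13-two` ((ii) literal) · `C13-deriv` (`∃ z'`) · `C13-sign` (`α` by reduction type, §2.2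
## l.380 verbatim) · PROVENANCE PRE ∘ PRE (Thm. 3.1 = erratum_OPEN ∘ Fouquet–Wan; Thm. 2.2).

## Contents (namespace `Literature.NumberTheory.EllipticCurves.Castella2024`)

* `Thm13Hypotheses` (structure, `Prop`), `thm13_charIdeal_torsion_eq_sq_OPEN` (ONE new named `Prop`,
  claim-tagged).
* PROVED: `Thm13Hypotheses.hypotheses` (Thm. 1.3's (i), (iii), (iv) CONTAIN Thm. 1.1's (i)–(iii) =
  `Castella2024.Hypotheses W p`: the ramified non-split `q ∥ N` is `≠ p` because `p` splits and `q`
  does not), `Thm13Hypotheses.p_ne_two`, `rankOne_of_thm13_OPEN`,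
  `charIdeal_torsion_eq_sq_of_thm13_OPEN_of_not_split` (+ `_dvd_`), `exists_derived_of_thm13_OPEN_of_split`.

## References
* [Castella2024] arXiv:2409.01360v1: Thm. 1.3 (l.305–325) and its proof (l.836–841), §1.1 (l.258–293),
  §2.1 (l.359–370), §2.2 (l.380, eq. (2.2)–(2.3)), Prop. 3.2 (l.753–784), Conj. 3.3 (l.789–794),
  Thm. 1.1 (l.214–226) and its proof (l.843 ff., the choice of `K`).
* [BertoliniDarmon1996] Invent. Math. 126, §2.5 eq. (7)–(8), Prop. 2.7 (the classes `z_m`).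
* [KellerYin2024] arXiv:2402.12781v2 Thm. 5.2.1 (the Eisenstein sibling). [PerrinRiou1987BSMF] Conj. B.
* Cell documents: `run/shared/lean/pub/bsd-littype/HANDOFF.md` §§ bsd-littype-05, bsd-littype-11;
  `run/shared/lean/pub/bsd-littype/OPEN-QUESTIONS-{05,11}.md`.
-/

set_option autoImplicit false

noncomputable section

open scoped Classical

open WeierstrassCurve NumberField IsDedekindDomain Literature.NumberTheory.EllipticCurves

universe u

namespace Literature.NumberTheory.EllipticCurves.Castella2024

variable (N : ℕ) [NeZero N] (W : WeierstrassCurve ℚ) [W.IsGloballyMinimal] (K : Type u) [Field K]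
  [NumberField K] (p : ℕ) [Fact p.Prime] (κ : ZpExtension K p) (γ : Field.absoluteGaloisGroup K)
  (jbar : AlgebraicClosure K →+* ℂ)

/-- **Hypotheses of Castella, arXiv:2409.01360v1, Theorem 1.3** for a globally minimal `W/ℚ`, word
for word (module docstring «Transcription»): `E` elliptic of conductor `N`; "`p > 3`" of
multiplicative reduction; `K` imaginary quadratic of odd discriminant `-D_K < -4` with (Heeg)
"there exists an ideal `𝔑 ⊂ 𝒪_K` with `𝒪_K/𝔑 ≃ ℤ/Nℤ`"; "`p` splits in `K`" (§2.1, standing; flag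
`C13-spl`); (i) `E[p]` irreducible; (ii) "If `2` is nonsplit in `K`, then `2 ∥ N`" (literal, flag
`C13-two`); (iii) nonsplit multiplicative reduction at each `q ∥ N` nonsplit in `K`, and some such `q`
at which `E[p]` is ramified (`p ∤ ord_q(Δ_min)`); (iv) `E(ℚ_p)[p] = 0`; `κ` the anticyclotomic
`ℤ_p`-extension with topological generator `γ`; and the EXTRA `p ∤ h_K` of the tree's Heegner-family
vocabulary (flag `C13-hK`). A predicate; nothing asserted. [claim: Castella2024, status: under-review] -/
structure Thm13Hypotheses : Prop where
  /-- `E` is an elliptic curve. -/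
  isElliptic : W.IsElliptic
  /-- `N` is the conductor of `E`. -/
  level : N = W.conductorNorm ℤ
  /-- "`p > 3`". -/
  five_le : 5 ≤ p
  /-- `E` has multiplicative reduction at `p` (`p ∥ N`). -/
  mult : W.HasMultiplicativeReductionAtPrime p
  /-- `K` is imaginary quadratic. -/
  isImaginaryQuadratic : IsImaginaryQuadratic K
  /-- "odd discriminant `-D_K`". -/
  discr_odd : Odd (discr K)
  /-- "`-D_K < -4`". -/
  discr_lt : discr K < -4
  /-- (Heeg): "there exists an ideal `𝔑 ⊂ 𝒪_K` with `𝒪_K/𝔑 ≃ ℤ/Nℤ`". -/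
  heegner_ideal : ∃ 𝔑 : Ideal (𝓞 K), Nonempty ((𝓞 K ⧸ 𝔑) ≃+* ZMod N)
  /-- §2.1 (standing): "the prime `p` splits in `K`, say `p = 𝔭𝔭̄`". -/
  split : ((Ideal.span {(p : ℤ)}).primesOver (𝓞 K)).ncard = 2
  /-- (i) `E[p]` is an irreducible `G_ℚ`-module. -/
  irr : W.HasIrreducibleModPGaloisRep p
  /-- (ii) "If `2` is nonsplit in `K`, then `2 ∥ N`" (literal). -/
  two : ((Ideal.span {(2 : ℤ)}).primesOver (𝓞 K)).ncard ≠ 2 → 2 ∣ N ∧ ¬ 4 ∣ N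
  /-- (iii), first clause: nonsplit multiplicative reduction at every `q ∥ N` nonsplit in `K`. -/
  nonsplit_mult : ∀ (q : ℕ) (_ : Fact q.Prime), q ∣ N → ¬ q ^ 2 ∣ N →
    ((Ideal.span {(q : ℤ)}).primesOver (𝓞 K)).ncard ≠ 2 →
    W.HasMultiplicativeReductionAtPrime q ∧ ¬ W.HasSplitMultiplicativeReductionAtPrime q
  /-- (iii), second clause: some `q ∥ N` nonsplit in `K` at which `E[p]` is ramified. -/
  exists_ramified : ∃ (q : ℕ) (_ : Fact q.Prime), q ∣ N ∧ ¬ q ^ 2 ∣ N ∧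
    ((Ideal.span {(q : ℤ)}).primesOver (𝓞 K)).ncard ≠ 2 ∧ ¬ p ∣ padicValInt q W.minimalDiscriminantInt
  /-- (iv) `E(ℚ_p)[p] = 0`. -/
  no_local_pTorsion : ∀ P : (W.baseChange ℚ_[p]).toAffine.Point, p • P = 0 → P = 0
  /-- EXTRA (special case, tree Heegner families: `K_n ⊆ K[p^{n+1}]`): `p ∤ h_K`. -/
  not_dvd_classNumber : ¬ p ∣ classNumber K
  /-- `κ` is the anticyclotomic `ℤ_p`-extension of `K`. -/
  anticyclotomic : κ.IsAnticyclotomic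
  /-- `γ` is a topological generator of `Gal(K_∞/K)`. -/
  topGenerator : κ.IsTopGenerator γ

-- TODO(general form): Castella allows `p ∣ h_K` (no hypothesis on `h_K` is printed); `not_dvd_classNumber`
-- is the tree vocabulary's (Howard 2004 §3.3) standing hypothesis. §2: "The results in this section
-- apply more generally to newforms of weight 2" (l.354).

/-- **OPEN HYPOTHESIS — UNREFEREED PREPRINT (Castella, arXiv:2409.01360v1, Theorem 1.3, label
`thm:HPMC`, TeX l.305–325).** Verbatim: "Let `E/ℚ` be an elliptic curve with multiplicative
reduction at the prime `p > 3`, and let `K` be an imaginary quadratic field of odd discriminant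
`-D_K < -4` satisfying hypothesis (Heeg) relative to the conductor `N` of `E`. Assume that: (i)–(iv)
[`Thm13Hypotheses`]. Then `X` and `𝔖_p` both have `Λ`-rank one with
`char_Λ(X_tors) = char_Λ(𝔖_p/Λ𝐳_∞^*)²`", `𝐳_∞^*` "the `Λ`-adic Heegner class `𝐳_∞` or its
derivative `𝐳_∞'` [`𝐳_∞ = (γ-1)𝐳_∞'`] according to whether `E` has nonsplit or split multiplicative
reduction at `p`" (l.289–293). TRANSCRIBED (module docstring; flags `C13-hK` / `-spl` / `-two` /
`-deriv` / `-sign`): under `Thm13Hypotheses` (special case `p ∤ h_K`), for every `Λ`-adic Selmer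
datum `D` (`𝔖_p`, `D.S`), Heegner family `F` at level `N = N_E` and Selmer-dual datum `X` (`X.X`)
of `E/K` along `κ`: `𝔖_p` and `X` are finitely generated of `Λ`-rank one; at NON-SPLIT `p`, for every
`z` with `IsLambdaAdicHeegnerClass D F (-1) z` (`α = a_p = -1`), `char_Λ(X_tors) = char_Λ(𝔖_p/Λz)²`;
at SPLIT `p`, for every `z` with `IsLambdaAdicHeegnerClass D F 1 z` there is `z'` with `z = T • z'`
(`T = γ - 1`) and `char_Λ(X_tors) = char_Λ(𝔖_p/Λz')²`. Printed proof: Thm. 3.1 (=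
`Castella2018.erratumThm11_exists_isBDPLFunction_isTorsion_charIdeal_eq_OPEN`, itself resting on
Fouquet–Wan arXiv:2107.13726) and Prop. 3.2 (explicit reciprocity law Thm. 2.2 / Cor. 2.3), after
[CV-dur, Thm. 1.10] (`𝐳_∞^*` non-torsion) and [BCK, Cor. 4.5] (`loc_𝔭 ≠ 0`) (l.836–841): PRE ∘ PRE.
NEVER cite this `Prop` as a theorem: take it as an explicit hypothesis; a result using it is conditional
on unrefereed claims. [claim: Castella2024, status: under-review]
[cite: BertoliniDarmon1996, §2.5 eq. (7)–(8), Prop. 2.7 (the regularized classes z_m, α = a_p = ±1; the transcription of Λ𝐳_∞)] -/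
def thm13_charIdeal_torsion_eq_sq_OPEN : Prop :=
  ∀ (_ : Thm13Hypotheses N W K p κ γ) (D : (W.baseChange K).LambdaAdicSelmerData κ γ)
    (F : HeegnerFamily N W K κ jbar) (X : (W.baseChange K).SelmerDualData κ γ),
    -- "`X` and `𝔖_p` both have `Λ`-rank one"
    (Module.Finite (IwasawaAlgebra p) D.S ∧ Module.finrank (IwasawaAlgebra p) D.S = 1) ∧
    (Module.Finite (IwasawaAlgebra p) X.X ∧ Module.finrank (IwasawaAlgebra p) X.X = 1) ∧
    -- non-split multiplicative `p` (`α = a_p = -1`): `𝐳_∞^* = 𝐳_∞`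
    (¬ W.HasSplitMultiplicativeReductionAtPrime p → ∀ z : D.S, IsLambdaAdicHeegnerClass D F (-1) z →
      Module.charIdeal (IwasawaAlgebra p) (Submodule.torsion (IwasawaAlgebra p) X.X) =
        Module.charIdeal (IwasawaAlgebra p) (D.S ⧸ Submodule.span (IwasawaAlgebra p) {z}) ^ 2) ∧
    -- split multiplicative `p` (`α = a_p = 1`): `𝐳_∞^* = 𝐳_∞'`, `𝐳_∞ = (γ - 1) 𝐳_∞'`
    (W.HasSplitMultiplicativeReductionAtPrime p → ∀ z : D.S, IsLambdaAdicHeegnerClass D F 1 z →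
      ∃ z' : D.S, z = (PowerSeries.X : IwasawaAlgebra p) • z' ∧
        Module.charIdeal (IwasawaAlgebra p) (Submodule.torsion (IwasawaAlgebra p) X.X) =
          Module.charIdeal (IwasawaAlgebra p) (D.S ⧸ Submodule.span (IwasawaAlgebra p) {z'}) ^ 2)

/-- **Castella 2024, Thm. 1.3 (Heegner point main statement at `p ∥ N`) — PINNED to a minimal-degree parametrisation with `p`-ADIC-UNIT MANIN CONSTANT** (BSD cited-literature audit ARM P, REGISTER R-15 / TY-QUEUE 25; reader bsd-cited-r19 sheets
`D-AUDIT-r19-ADDENDUM-5.md` sha16 6a0e68f1a5f0faa2 §4, ADDENDUM-6 c1c6b9e51d6d0dd9 and ADDENDUM-8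
24e75636994fcc95 (v2) §4 (the Manin pin, rider R-b of r17 ADDENDUM-4 0434952c634f1c51); typer bsd-cited-ty4 g7/g8/g10,
2026-08-27; lead rulings (181)/(198)/(243) + RULING (316) «TYQ 25: kit v5.2 is the release shape»): the statement of
`thm13_charIdeal_torsion_eq_sq_OPEN` (kept byte-identical above) with TWO extra hypotheses as binders right after `F`:
(F1) `∀ Dt', F.Dt.deg ≤ Dt'.deg` — minimal modular degree among the data of the same curve and level (`φ = ±φ_min`) =
VERBATIM the body of `ModularForms.ModularParametrizationData.IsMinimal F.Dt` (`ModularParametrizationScalingProofs.lean`,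
p482958: `exists_isMinimal`, `IsMinimal.deg_eq`, `not_isMinimal_zsmul`), spelled out because that module lies DOWNSTREAM of
this file (an `import` would close a cycle); the two agree by `Iff.rfl` — kernel lemma `TYQ25Check.pin_iff_isMinimal_heegnerFamily`
of the kit file `run/shared/lean/pub/bsd-cited/staging/bsd-cited-ty4/TYQ25-kit/check/K_TYQ25_pin_iff_isMinimal.lean` sha16
3e421a28abe396fd (imports both modules; farm rc 0, axioms trio; lead (243)).
(F1′, the MANIN PIN) `¬ (p : ℤ) ∣ F.Dt.c` — the Manin constant of `φ` (`φ^*ω_W = c · 2πi f dτ`) is a `p`-adic unit: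
Perrin-Riou's Conj. B carries the factor `c_π · (#𝒪_K^× / 2)` [PR87 §1 p. 405; BCK21 Rem. after Conj. 1], which the `c`-free
form printed here drops exactly when it is a `p`-adic unit (Mazur 1978 Cor. 4.1 for the OPTIMAL curve; NOT automatic for a
non-optimal curve at an Eisenstein `p` — PR87 p. 409 Ex. 3, `X_0(11)/μ_5` at `p = 5`); inside the pin the statement does
not depend on the parametrisation (r19 ADD-8 kernel `sheets/r19-add8/d_audit_r19_add8_manin_pin_check.lean` f8a7d8f730b7607f,
K2 `nonsplitClause_iff_zsmul` / `charIdeal_quot_span_C_smul_eq_of_not_dvd`, K3 shapes `…ManinPinned`; TREE theorems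
`heegnerCharIdeal_zsmul_of_not_dvd` / `heegnerModule_zsmul_of_not_dvd` / `charIdeal_quotient_span_C_smul_eq_of_not_dvd` of
`HeegnerModuleScalingProofs.lean`, p496710 — downstream of this file), outside it the `∀ F`
layout is refuted (p482958), and on `S_bad(p) = {W : p ∣ c(π_min W)}` the twin is vacuous (no `c`-free integral statement
is in print there — r19 ADD-8 §0 (a)/(b), §3) — VOID on this file's locus: `Thm13Hypotheses.irr` gives `S_bad(p) = ∅` and F1 ⇒ F1′ (Mazur
Cor. 4.1 for the optimal curve via `ModularForms.mazur_not_dvd_maninConstant_of_odd` + cyclic isogenies of degree prime to `p`), so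
the Manin pin is carried here for uniformity with the six sibling twins (r17 NOTE e8a7e46a994688ce, conformity NOTE 09286b51a92fc1a1;
r19 ADD-8 v2 §0). WHY: print works with ONE fixed parametrisation ([Cas24] «Upon the choice of a modular parametrization `X_0(N) → E`, … which we fix from now on», TeX l.268), whereas `∀ (F : HeegnerFamily …)` ranges over every
rescaling `[m] ∘ φ` of it (`F.Dt.c ↦ m · F.Dt.c`; points and `Λ`-adic class scale by `m` — kernel theorems
`HeegnerFamily.zsmul` / `KellerYin2024.false_of_thm521_OPEN_zsmul` (p481261), `HeegnerFamily.zsmulSelf` /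
`false_of_thm521_OPEN_of_witness` (p482958)), and an INTEGRAL equality of characteristic ideals cannot hold for a class
and its `p`-multiple at once (`char_Λ(𝔖/Λpz) = (p) · char_Λ(𝔖/Λz)`): the unpinned binder above is STRONGER than print, this
pinned one is print's statement (reader's verdict word VERBATIM-SPECIALISED; flag `HPMC-Manin-normalisation`, priced by the
desks). The bridge `thm13_charIdeal_torsion_eq_sq_minimal_OPEN_of_unpinned` (unpinned ⇒ pinned) is PROVED, so nothing is asserted beyond the declaration above;
divisibility-shaped binders are unaffected (r19 ADD-5 §4.3).
NEVER cite this `Prop` as a theorem: take it as an explicit hypothesis; a result using it is conditional on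
unrefereed claims.
[claim: Castella2024, status: under-review]
[cite: BertoliniDarmon1996, §2.5 eq. (7)–(8), Prop. 2.7 (the regularized classes z_m, α = a_p = ±1; the transcription of Λ𝐳_∞)]
[cite: PerrinRiou1987BSMF, §1 Conj. B p. 405 (the factor c_π · u)] [cite: BurungaleCastellaKim2021, Remark after Conj. 1 (the factor c_π · #𝒪_K^× / 2; Mazur for p ∤ N)] -/
def thm13_charIdeal_torsion_eq_sq_minimal_OPEN : Prop :=
  ∀ (_ : Thm13Hypotheses N W K p κ γ) (D : (W.baseChange K).LambdaAdicSelmerData κ γ)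
    (F : HeegnerFamily N W K κ jbar)
    -- PINNED (fix F1): `F.Dt` has minimal modular degree (`φ = ±φ_min`) — verbatim the body of
    -- `ModularForms.ModularParametrizationData.IsMinimal F.Dt` (`ModularParametrizationScalingProofs.lean`)
    (_ : ∀ Dt' : ModularForms.ModularParametrizationData W N, F.Dt.deg ≤ Dt'.deg)
    -- PINNED (fix F1′, the Manin pin — rider R-b): the parametrisation's Manin constant is a `p`-adic unit
    (_ : ¬ (p : ℤ) ∣ F.Dt.c)
    (X : (W.baseChange K).SelmerDualData κ γ),
    -- "`X` and `𝔖_p` both have `Λ`-rank one"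
    (Module.Finite (IwasawaAlgebra p) D.S ∧ Module.finrank (IwasawaAlgebra p) D.S = 1) ∧
    (Module.Finite (IwasawaAlgebra p) X.X ∧ Module.finrank (IwasawaAlgebra p) X.X = 1) ∧
    -- non-split multiplicative `p` (`α = a_p = -1`): `𝐳_∞^* = 𝐳_∞`
    (¬ W.HasSplitMultiplicativeReductionAtPrime p → ∀ z : D.S, IsLambdaAdicHeegnerClass D F (-1) z →
      Module.charIdeal (IwasawaAlgebra p) (Submodule.torsion (IwasawaAlgebra p) X.X) =
        Module.charIdeal (IwasawaAlgebra p) (D.S ⧸ Submodule.span (IwasawaAlgebra p) {z}) ^ 2) ∧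
    -- split multiplicative `p` (`α = a_p = 1`): `𝐳_∞^* = 𝐳_∞'`, `𝐳_∞ = (γ - 1) 𝐳_∞'`
    (W.HasSplitMultiplicativeReductionAtPrime p → ∀ z : D.S, IsLambdaAdicHeegnerClass D F 1 z →
      ∃ z' : D.S, z = (PowerSeries.X : IwasawaAlgebra p) • z' ∧
        Module.charIdeal (IwasawaAlgebra p) (Submodule.torsion (IwasawaAlgebra p) X.X) =
          Module.charIdeal (IwasawaAlgebra p) (D.S ⧸ Submodule.span (IwasawaAlgebra p) {z'}) ^ 2)

variable {N W K p κ γ jbar}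

/-- **Bridge, PROVED**: the unpinned `thm13_charIdeal_torsion_eq_sq_OPEN` implies its pinned twin (the two extra
hypotheses are discarded) — so the twin is a WEAKENING, never a strengthening. [claim: Castella2024, status: under-review] -/
theorem thm13_charIdeal_torsion_eq_sq_minimal_OPEN_of_unpinned
    (h : thm13_charIdeal_torsion_eq_sq_OPEN N W K p κ γ jbar) :
    thm13_charIdeal_torsion_eq_sq_minimal_OPEN N W K p κ γ jbar :=
  fun hyp D F _ _ X ↦ h hyp D F X

omit [NeZero N] in
/-- "`p > 3`" makes `p` odd. [claim: Castella2024, status: under-review] -/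
theorem Thm13Hypotheses.p_ne_two (hyp : Thm13Hypotheses N W K p κ γ) : p ≠ 2 := by
  have := hyp.five_le
  omega

omit [NeZero N] in
/-- **Theorem 1.3's hypotheses CONTAIN Theorem 1.1's (i)–(iii)** (`Castella2024.Hypotheses W p` of
`MultiplicativePConverse.lean`): (i) and (iv) literally; Thm. 1.1 (ii) "nonsplit multiplicative
reduction at some prime `q ≠ p` where `E[p]` is ramified" from Thm. 1.3 (iii): the ramified `q ∥ N`
nonsplit in `K` has nonsplit multiplicative reduction (first clause) and `q ≠ p` because `p` splits in
`K` while `q` does not. (This is how §3.2 applies Thm. 1.3 "for a carefully chosen `K`" to get Thm.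
1.1.) [claim: Castella2024, status: under-review] -/
theorem Thm13Hypotheses.hypotheses (hyp : Thm13Hypotheses N W K p κ γ) : Hypotheses W p where
  irr := hyp.irr
  nonsplit_ramified := by
    obtain ⟨q, hq, hqN, hq2, hns, hram⟩ := hyp.exists_ramified
    refine ⟨q, hq, ?_, (hyp.nonsplit_mult q hq hqN hq2 hns).1, (hyp.nonsplit_mult q hq hqN hq2 hns).2,
      hram⟩
    rintro rfl
    exact hns hyp.split
  no_local_pTorsion := hyp.no_local_pTorsion

/-- **Thm. 1.3 ⇒ the two rank clauses**: `𝔖_p` and `X` are finitely generated of `Λ`-rank one.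
CONDITIONAL on the OPEN fact. [claim: Castella2024, status: under-review] -/
theorem rankOne_of_thm13_OPEN (h : thm13_charIdeal_torsion_eq_sq_OPEN N W K p κ γ jbar)
    (hyp : Thm13Hypotheses N W K p κ γ) (D : (W.baseChange K).LambdaAdicSelmerData κ γ)
    (F : HeegnerFamily N W K κ jbar) (X : (W.baseChange K).SelmerDualData κ γ) :
    (Module.Finite (IwasawaAlgebra p) D.S ∧ Module.finrank (IwasawaAlgebra p) D.S = 1) ∧
      (Module.Finite (IwasawaAlgebra p) X.X ∧ Module.finrank (IwasawaAlgebra p) X.X = 1) :=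
  ⟨(h hyp D F X).1, (h hyp D F X).2.1⟩

/-- **Thm. 1.3 at a NON-SPLIT multiplicative `p`**: `char_Λ(X_tors) = char_Λ(𝔖_p/Λ𝐳_∞)²` for the
`Λ`-adic Heegner class `𝐳_∞` of sign `α = a_p = -1`. CONDITIONAL on the OPEN fact.
[claim: Castella2024, status: under-review] -/
theorem charIdeal_torsion_eq_sq_of_thm13_OPEN_of_not_split
    (h : thm13_charIdeal_torsion_eq_sq_OPEN N W K p κ γ jbar)
    (hyp : Thm13Hypotheses N W K p κ γ) (hns : ¬ W.HasSplitMultiplicativeReductionAtPrime p)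
    (D : (W.baseChange K).LambdaAdicSelmerData κ γ) (F : HeegnerFamily N W K κ jbar)
    (X : (W.baseChange K).SelmerDualData κ γ) {z : D.S} (hz : IsLambdaAdicHeegnerClass D F (-1) z) :
    Module.charIdeal (IwasawaAlgebra p) (Submodule.torsion (IwasawaAlgebra p) X.X) =
      Module.charIdeal (IwasawaAlgebra p) (D.S ⧸ Submodule.span (IwasawaAlgebra p) {z}) ^ 2 :=
  (h hyp D F X).2.2.1 hns z hz

/-- Non-split case, divisibility form (Howard Thm. B (c) shape): `char_Λ(X_tors) ∣ char_Λ(𝔖_p/Λ𝐳_∞)²`.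
CONDITIONAL on the OPEN fact. [claim: Castella2024, status: under-review] -/
theorem charIdeal_torsion_dvd_sq_of_thm13_OPEN_of_not_split
    (h : thm13_charIdeal_torsion_eq_sq_OPEN N W K p κ γ jbar)
    (hyp : Thm13Hypotheses N W K p κ γ) (hns : ¬ W.HasSplitMultiplicativeReductionAtPrime p)
    (D : (W.baseChange K).LambdaAdicSelmerData κ γ) (F : HeegnerFamily N W K κ jbar)
    (X : (W.baseChange K).SelmerDualData κ γ) {z : D.S} (hz : IsLambdaAdicHeegnerClass D F (-1) z) :
    Module.charIdeal (IwasawaAlgebra p) (Submodule.torsion (IwasawaAlgebra p) X.X) ∣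
      Module.charIdeal (IwasawaAlgebra p) (D.S ⧸ Submodule.span (IwasawaAlgebra p) {z}) ^ 2 :=
  dvd_of_eq (charIdeal_torsion_eq_sq_of_thm13_OPEN_of_not_split h hyp hns D F X hz)

/-- **Thm. 1.3 at a SPLIT multiplicative `p` (exceptional zero, Thm. 2.1: `pr_0(𝐳_∞) = 0`)**: the
class `𝐳_∞` of sign `α = a_p = 1` is `(γ-1) • 𝐳_∞'` for some `𝐳_∞' ∈ 𝔖_p` with
`char_Λ(X_tors) = char_Λ(𝔖_p/Λ𝐳_∞')²`. CONDITIONAL on the OPEN fact.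
[claim: Castella2024, status: under-review] -/
theorem exists_derived_of_thm13_OPEN_of_split
    (h : thm13_charIdeal_torsion_eq_sq_OPEN N W K p κ γ jbar)
    (hyp : Thm13Hypotheses N W K p κ γ) (hs : W.HasSplitMultiplicativeReductionAtPrime p)
    (D : (W.baseChange K).LambdaAdicSelmerData κ γ) (F : HeegnerFamily N W K κ jbar)
    (X : (W.baseChange K).SelmerDualData κ γ) {z : D.S} (hz : IsLambdaAdicHeegnerClass D F 1 z) :
    ∃ z' : D.S, z = (PowerSeries.X : IwasawaAlgebra p) • z' ∧
      Module.charIdeal (IwasawaAlgebra p) (Submodule.torsion (IwasawaAlgebra p) X.X) =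
        Module.charIdeal (IwasawaAlgebra p) (D.S ⧸ Submodule.span (IwasawaAlgebra p) {z'}) ^ 2 :=
  (h hyp D F X).2.2.2 hs z hz

end Literature.NumberTheory.EllipticCurves.Castella2024

end
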